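import Literature.AlgebraicGeometry.Milne1999.HodgeGroupProductsSplitting
import HarnessLib

/-!
# `Hg(B^{m+1} × C^{n+1}) = Hg(B × C)` acting block-diagonally (Moonen–Zarhin 1999, §1), and (3.1) for ALL exponents: the Hodge group of `B × C` splits iff the Hodge classes of every `B^{m+1} × C^{n+1}` are spanned by the exterior products (Tannaka-free, on the real carriers)

Family `hodge`, layer `Literature/AlgebraicGeometry/Milne1999`, namespace `Literature.AlgebraicGeometry.Milne1999` (D-0022).
THEOREMS ONLY (no definition, no named fact, no `sorry`; net debt 0). Sequel of `Milne1999/HodgeGroupProductsSplitting` (the shuffle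
`(B × C)^{a+1} ≅ B^{a+1} × C^{a+1}`, transfer of `Hg`-membership along an intertwining retraction, `Hg(B × C) ≤ Hg(B) × Hg(C)`, Moonen–Zarhin
(3.1) for equal exponents) and of `Milne1999/HodgeGroupPowersDiagonal` (`Hg(A^{r+1}) = Hg(A)` diagonally), written for the cell
`pub-hodge-ring2` (HONEST FRAMING: research route conditional on HC_CM; not a corollary; Q11.4-sentence-2 already refuted in dim ≥ 3;
seat `ring2-b06`, gen 87). It closes the item that file lists under "What is NOT here": UNEQUAL EXPONENTS. Nothing here is a case of
the Hodge conjecture; a theorem in print about Hodge structures, certified on the tree's carriers.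

## Source, verbatim (held text `paper:arxiv-math_9901113` = B. Moonen, Yu. G. Zarhin, Math. Ann. 315 (1999) 711–733, chunk p0002
L137–L141 and p0006 L54–L58, re-opened)

* §1: "For `n ≥ 1` we can identify `Hg(Xⁿ)` with `Hg(X)`, acting diagonally on `V_{Xⁿ} = (V_X)ⁿ`. More generally, if
  `n_1, …, n_r ∈ ℤ_{≥1}` then we can identify `Hg(X_1^{n_1} × ⋯ × X_r^{n_r})` with `Hg(X_1 × ⋯ × X_r)`."
* §3 (3.1): "We may have that `Hg(X_1 × X_2) ≠ Hg(X_1) × Hg(X_2)`. (1) […] This holds if and only if for some `m` and `n` the Hodge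
  ring `B(X_1^m × X_2^n)` is not generated by the elements coming from `B(X_1^m)` and `B(X_2^n)`."

## What is proved (`Hg(Y)(ℂ) = HodgeTheory.hodgeGroup (dim Y) Y.X`, Tannaka-free; `Hg(Y)(ℂ)|_{H¹} = VanGeemen1994.hodgeGroupOne`;
`u^{⊕(m+1)} = diagPow`, `s ⊕ t = prodBlockDiagEquiv`, `⋀•w = (exteriorPullbackEquiv … w k)_k`)

* §1 plumbing: `B^{m+1}` and `C^{n+1}` are retracts of `B^{m+n+2}`, `C^{m+n+2}` (`exists_retraction_powSucc_left/right`, from the lane's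
  `exists_retraction_powSucc_prod_powSucc`), every homomorphism between powers intertwining the diagonals of `u ∈ C(B) ⊗ ℂ`
  (the lane's `diagPow_map_powSucc`); products of retractions intertwine block sums (private, as in the prequel).
* §2 **`Hg(B^{m+1} × C^{n+1}) = Hg(B × C)`, BLOCK-DIAGONALLY** (the case `r = 2` of Moonen–Zarhin §1, second sentence):
  `diagPow_prodBlockDiagEquiv_mem_hodgeGroup_of_mem` (`⊇`: if `⋀•(u ⊕ v) ∈ Hg(B × C)` then `⋀•(u^{⊕(m+1)} ⊕ v^{⊕(n+1)}) ∈ Hg(B^{m+1} × C^{n+1})`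
  — go up to `(B × C)^{N+1}`, `N = m + n + 1`, by `Hg((B × C)^{N+1}) = Hg(B × C)`, shuffle to `B^{N+1} × C^{N+1}` and retract),
  `exists_of_mem_hodgeGroup_powSucc_prod_powSucc` (`⊆`: every element of `Hg(B^{m+1} × C^{n+1})` is of that form with
  `⋀•(u ⊕ v) ∈ Hg(B × C)` — blocks by the prequel's §2, diagonal by Moonen–Zarhin §1, and retract `B × C ⊂ B^{m+1} × C^{n+1}`),
  `mem_hodgeGroup_powSucc_prod_powSucc_iff`.
* §3 **(3.1) FOR ALL EXPONENTS**: if `Hg(B × C)` splits (`∀ u ∈ Hg(B)|_{H¹}, v ∈ Hg(C)|_{H¹}, ⋀•(u ⊕ v) ∈ Hg(B × C)`) then `Hg(B^{m+1} × C^{n+1})`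
  splits (`forall_prodBlockDiagEquiv_mem_hodgeGroup_powSucc_prod_powSucc`) and `HodgeClassesProductSpan (B^{m+1}) (C^{n+1})` for ALL
  `m`, `n` (`hodgeClassesProductSpan_powSucc_powSucc_of_…`); the criterion with both exponents free
  (`forall_prodBlockDiagEquiv_mem_hodgeGroup_iff_forall_hodgeClassesProductSpan_powSucc_powSucc`) — Moonen–Zarhin's printed form; and
  the Hodge conjecture for `B^{m+1}`, `C^{n+1}` gives it for `B^{m+1} × C^{n+1}` under splitting.

## What is NOT here

`r ≥ 3` factors (iterate); the surjectivity of the projections `Hg(X) → Hg(X_i)`; any criterion FOR splitting; the analogous statements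
for the other stabilisers of the `pub-hodge-ring2` dictionary (same mechanism, `Summits/…/Ring2HypothesesDescentAbsoluteExteriorStabilizerProducts`).
PRESEARCH as in the prequel (Moonen–Zarhin §1 / §3 re-opened; no Tannaka-free carrier statement in the held corpora; certification, no
novelty claimed).

## References

* [MoonenZarhin1999LowDim] B. Moonen, Yu. G. Zarhin, Hodge classes on abelian varieties of low dimension, Math. Ann. 315 (1999)
  711–733: §1, §3 (3.1).
* [Milne1999LefschetzClasses] J. S. Milne, Lefschetz classes on abelian varieties, Duke Math. J. 96 (1999): §1 p. 643, Thm. 4.4.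
* [LangeBirkenhake1992] H. Lange, Ch. Birkenhake, Complex Abelian Varieties (1992): Lemma 1.1.17, Thm. 4.2.1.
* [HatcherAT2002] A. Hatcher, Algebraic Topology (2002): §3.2 Thm. 3.16.
* [vanGeemen1994HodgeAV] B. van Geemen, An introduction to the Hodge conjecture for abelian varieties, LNM 1594 (1994): Lemma 3.7, 6.4–6.5.
-/

noncomputable section

open CategoryTheory MonoidalCategory CartesianMonoidalCategory
open Literature.AlgebraicTopology.SingularHomology
open Literature.AlgebraicGeometry.HodgeTheory
open Literature.AlgebraicGeometry.Motives
open Literature.AlgebraicGeometry.VanGeemen1994 (hodgeGroupOne mem_hodgeGroupOne_iff)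

namespace Literature.AlgebraicGeometry.Milne1999

/-! ### §1 Plumbing: retractions `B^{m+1} ⇄ B^{m+n+2} ⇆ B^{n+1}`, products of retractions -/

section Plumbing

/-- A product of retractions is a retraction (generic objects). [folklore] -/
private theorem retraction_prod {X X' Y Y' : AbelianVariety ℂ} {ι : X ⟶ X'} {π : X' ⟶ X} (h : ι ≫ π = 𝟙 X) {ι₀ : Y ⟶ Y'}
    {π₀ : Y' ⟶ Y} (h₀ : ι₀ ≫ π₀ = 𝟙 Y) :
    AbelianVariety.prodLift (AbelianVariety.fst X Y ≫ ι) (AbelianVariety.snd X Y ≫ ι₀) ≫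
        AbelianVariety.prodLift (AbelianVariety.fst X' Y' ≫ π) (AbelianVariety.snd X' Y' ≫ π₀) = 𝟙 (X.prod Y) := by
  refine AbelianVariety.prod_hom_ext ?_ ?_
  · rw [Category.assoc, AbelianVariety.prodLift_fst, ← Category.assoc, AbelianVariety.prodLift_fst, Category.assoc, h,
      Category.id_comp, Category.comp_id]
  · rw [Category.assoc, AbelianVariety.prodLift_snd, ← Category.assoc, AbelianVariety.prodLift_snd, Category.assoc, h₀,
      Category.id_comp, Category.comp_id]

/-- A product `π × π₀` of homomorphisms intertwining `H¹`-automorphisms blockwise intertwines the block sums (generic objects).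
[cite: Milne1999LefschetzClasses, §1 p. 643] [cite: HatcherAT2002, §3.2 Thm. 3.16] -/
private theorem intertwine_prod {X X' Y Y' : AbelianVariety ℂ} (π : X' ⟶ X) (π₀ : Y' ⟶ Y)
    (UX' : complexBetti X'.X 1 ≃ₗ[ℂ] complexBetti X'.X 1) (UX : complexBetti X.X 1 ≃ₗ[ℂ] complexBetti X.X 1)
    (UY' : complexBetti Y'.X 1 ≃ₗ[ℂ] complexBetti Y'.X 1) (UY : complexBetti Y.X 1 ≃ₗ[ℂ] complexBetti Y.X 1)
    (hX : ∀ q : complexBetti X.X 1, UX' (complexBetti.map π.hom.hom.hom 1 q) = complexBetti.map π.hom.hom.hom 1 (UX q))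
    (hY : ∀ z : complexBetti Y.X 1, UY' (complexBetti.map π₀.hom.hom.hom 1 z) = complexBetti.map π₀.hom.hom.hom 1 (UY z))
    (y : complexBetti (X.prod Y).X 1) :
    prodBlockDiagEquiv UX' UY' (complexBetti.map
        (AbelianVariety.prodLift (AbelianVariety.fst X' Y' ≫ π) (AbelianVariety.snd X' Y' ≫ π₀)).hom.hom.hom 1 y) =
      complexBetti.map (AbelianVariety.prodLift (AbelianVariety.fst X' Y' ≫ π) (AbelianVariety.snd X' Y' ≫ π₀)).hom.hom.hom 1
        (prodBlockDiagEquiv UX UY y) :=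
  apply_map_eq_map_prodBlockDiagEquiv _ _ _ _
    (fun q ↦ by rw [AbelianVariety.prodLift_fst, complexBetti_map_comp_apply, complexBetti_map_comp_apply,
      prodBlockDiagEquiv_apply_map_fst, hX])
    (fun z ↦ by rw [AbelianVariety.prodLift_snd, complexBetti_map_comp_apply, complexBetti_map_comp_apply,
      prodBlockDiagEquiv_apply_map_snd, hY]) y

/-- Retractions compose (generic objects). [folklore] -/
private theorem retraction_comp {X Y Z : AbelianVariety ℂ} {ι : X ⟶ Y} {π : Y ⟶ X} (h : ι ≫ π = 𝟙 X) {ι' : Y ⟶ Z} {π' : Z ⟶ Y}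
    (h' : ι' ≫ π' = 𝟙 Y) : (ι ≫ ι') ≫ (π' ≫ π) = 𝟙 X := by
  rw [Category.assoc, ← Category.assoc ι', h', Category.id_comp, h]

variable (B C : AbelianVariety ℂ) (m n : ℕ)

/-- **`B^{m+1}` is a retract of `B^{m+n+2}`** (`B^{m+1} ⊂ B^{m+1} × B^{n+1} ⊂ B^{m+n+2}`; the lane's `exists_retraction_powSucc_prod_powSucc`).
[cite: LangeBirkenhake1992, Thm. 4.2.1] -/
theorem exists_retraction_powSucc_left :
    ∃ (ι : B.powSucc m ⟶ B.powSucc (m + n + 1)) (π : B.powSucc (m + n + 1) ⟶ B.powSucc m), ι ≫ π = 𝟙 _ := by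
  obtain ⟨ι, π, h⟩ := exists_retraction_powSucc_prod_powSucc B m n
  exact ⟨AbelianVariety.prodLift (𝟙 _) (0 : B.powSucc m ⟶ B.powSucc n) ≫ ι, π ≫ AbelianVariety.fst _ _,
    retraction_comp (AbelianVariety.prodLift_fst _ _) h⟩

/-- **`C^{n+1}` is a retract of `C^{m+n+2}`** (`C^{n+1} ⊂ C^{m+1} × C^{n+1} ⊂ C^{m+n+2}`). [cite: LangeBirkenhake1992, Thm. 4.2.1] -/
theorem exists_retraction_powSucc_right :
    ∃ (ι : C.powSucc n ⟶ C.powSucc (m + n + 1)) (π : C.powSucc (m + n + 1) ⟶ C.powSucc n), ι ≫ π = 𝟙 _ := by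
  obtain ⟨ι, π, h⟩ := exists_retraction_powSucc_prod_powSucc C m n
  exact ⟨AbelianVariety.prodLift (0 : C.powSucc n ⟶ C.powSucc m) (𝟙 _) ≫ ι, π ≫ AbelianVariety.snd _ _,
    retraction_comp (AbelianVariety.prodLift_snd _ _) h⟩

end Plumbing

/-! ### §2 `Hg(B^{m+1} × C^{n+1}) = Hg(B × C)`, block-diagonally (Moonen–Zarhin §1, second sentence, `r = 2`) -/

section ProductsPowers

variable (B C : AbelianVariety ℂ) (m n : ℕ)

/-- **`⊇`: if `⋀•(u ⊕ v) ∈ Hg(B × C)(ℂ)` then `⋀•(u^{⊕(m+1)} ⊕ v^{⊕(n+1)}) ∈ Hg(B^{m+1} × C^{n+1})(ℂ)`.** With `N = m + n + 1`: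
`⋀•((u ⊕ v)^{⊕(N+1)}) ∈ Hg((B × C)^{N+1})` (Moonen–Zarhin §1, `diagPowExterior_mem_hodgeGroup_powSucc`); the shuffle
`σ : (B × C)^{N+1} ≅ B^{N+1} × C^{N+1}` intertwines it with `⋀•(u^{⊕(N+1)} ⊕ v^{⊕(N+1)})` (prequel §0), and the product of the retractions
`B^{N+1} → B^{m+1}`, `C^{N+1} → C^{n+1}` (§1; they intertwine the diagonals because `u ∈ C(B) ⊗ ℂ`, `v ∈ C(C) ⊗ ℂ`, Milne §1) carries it
to `B^{m+1} × C^{n+1}` (prequel's `exteriorPullbackEquiv_mem_hodgeGroup_of_retraction`). [cite: MoonenZarhin1999LowDim, §1]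
[cite: Milne1999LefschetzClasses, §1 p. 643] -/
theorem diagPow_prodBlockDiagEquiv_mem_hodgeGroup_of_mem {u : complexBetti B.X 1 ≃ₗ[ℂ] complexBetti B.X 1}
    (hu : u ∈ hodgeGroupOne B.dim B.X) {v : complexBetti C.X 1 ≃ₗ[ℂ] complexBetti C.X 1} (hv : v ∈ hodgeGroupOne C.dim C.X)
    (h : (fun k ↦ exteriorPullbackEquiv (AbelianVariety.hasExteriorCohomologyH1_complexPoints (B.prod C)) (prodBlockDiagEquiv u v) k) ∈
      hodgeGroup (B.prod C).dim (B.prod C).X) :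
    (fun k ↦ exteriorPullbackEquiv (AbelianVariety.hasExteriorCohomologyH1_complexPoints ((B.powSucc m).prod (C.powSucc n)))
        (prodBlockDiagEquiv (diagPow B u m) (diagPow C v n)) k) ∈
      hodgeGroup ((B.powSucc m).prod (C.powSucc n)).dim ((B.powSucc m).prod (C.powSucc n)).X := by
  have huC : u ∈ centralizerGroup B := hodgeGroupOne_le_centralizerGroup hu
  have hvC : v ∈ centralizerGroup C := hodgeGroupOne_le_centralizerGroup hv
  -- up to `(B × C)^{N+1}`, `N = m + n + 1`
  have h1 : prodBlockDiagEquiv u v ∈ hodgeGroupOne (B.prod C).dim (B.prod C).X :=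
    mem_hodgeGroupOne_iff.2 ⟨_, h, exteriorPullbackEquiv_one_eq _ _⟩
  have hN := diagPowExterior_mem_hodgeGroup_powSucc (B.prod C) (m + n + 1) h1
  -- the retraction `(B × C)^{N+1} → B^{N+1} × C^{N+1} → B^{m+1} × C^{n+1}` and its section
  obtain ⟨σ, τ, -, hτσ, hint⟩ := exists_shuffle_powSucc_prod B C (m + n + 1)
  obtain ⟨ιB, πB, hB⟩ := exists_retraction_powSucc_left B m n
  obtain ⟨ιC, πC, hC⟩ := exists_retraction_powSucc_right C m n
  refine exteriorPullbackEquiv_mem_hodgeGroup_of_retraction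
    (AbelianVariety.prodLift (AbelianVariety.fst _ _ ≫ ιB) (AbelianVariety.snd _ _ ≫ ιC) ≫ τ)
    (σ ≫ AbelianVariety.prodLift (AbelianVariety.fst _ _ ≫ πB) (AbelianVariety.snd _ _ ≫ πC))
    (retraction_comp (retraction_prod hB hC) hτσ) (fun y ↦ ?_) hN
  rw [complexBetti_map_comp_apply, complexBetti_map_comp_apply, hint u v,
    intertwine_prod πB πC (diagPow B u (m + n + 1)) (diagPow B u m) (diagPow C v (m + n + 1)) (diagPow C v n)
      (fun q ↦ diagPow_map_powSucc huC _ _ πB q) (fun z ↦ diagPow_map_powSucc hvC _ _ πC z) y]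

/-- **`⊆`: every element of `Hg(B^{m+1} × C^{n+1})(ℂ)` is `⋀•(u^{⊕(m+1)} ⊕ v^{⊕(n+1)})` with `u ∈ Hg(B)|_{H¹}`, `v ∈ Hg(C)|_{H¹}` and
`⋀•(u ⊕ v) ∈ Hg(B × C)(ℂ)`.** Blocks in `Hg(B^{m+1})`, `Hg(C^{n+1})` by the prequel's `Hg(Y × Z) ≤ Hg(Y) × Hg(Z)`; they are diagonal by
Moonen–Zarhin §1 (`mem_hodgeGroupOne_powSucc_iff`); and `⋀•(u ⊕ v) ∈ Hg(B × C)` by transfer along the retraction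
`B^{m+1} × C^{n+1} → B × C` (product of sections of the last factors, which intertwine `u^{⊕(m+1)} ⊕ v^{⊕(n+1)}` with `u ⊕ v`).
[cite: MoonenZarhin1999LowDim, §1 and §3 (3.1)] [cite: Milne1999LefschetzClasses, §1 p. 643] -/
theorem exists_of_mem_hodgeGroup_powSucc_prod_powSucc
    {g' : ∀ k : ℕ, complexBetti ((B.powSucc m).prod (C.powSucc n)).X k ≃ₗ[ℂ] complexBetti ((B.powSucc m).prod (C.powSucc n)).X k}
    (hg' : g' ∈ hodgeGroup ((B.powSucc m).prod (C.powSucc n)).dim ((B.powSucc m).prod (C.powSucc n)).X) :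
    ∃ u ∈ hodgeGroupOne B.dim B.X, ∃ v ∈ hodgeGroupOne C.dim C.X,
      (fun k ↦ exteriorPullbackEquiv (AbelianVariety.hasExteriorCohomologyH1_complexPoints (B.prod C)) (prodBlockDiagEquiv u v) k) ∈
          hodgeGroup (B.prod C).dim (B.prod C).X ∧
        g' = fun k ↦ exteriorPullbackEquiv (AbelianVariety.hasExteriorCohomologyH1_complexPoints ((B.powSucc m).prod (C.powSucc n)))
          (prodBlockDiagEquiv (diagPow B u m) (diagPow C v n)) k := by
  obtain ⟨U, hU, V, hV, hg'eq⟩ := exists_eq_prodBlockDiagEquiv_of_mem_hodgeGroup_prod (B.powSucc m) (C.powSucc n) hg'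
  obtain ⟨u, hu, rfl⟩ := (mem_hodgeGroupOne_powSucc_iff B m U).1 hU
  obtain ⟨v, hv, rfl⟩ := (mem_hodgeGroupOne_powSucc_iff C n V).1 hV
  have huC : u ∈ centralizerGroup B := hodgeGroupOne_le_centralizerGroup hu
  have hvC : v ∈ centralizerGroup C := hodgeGroupOne_le_centralizerGroup hv
  refine ⟨u, hu, v, hv, ?_, hg'eq⟩
  -- transfer along `B × C ⊂ B^{m+1} × C^{n+1}` (sections of the powers, blockwise)
  obtain ⟨ιB, πB, hB⟩ := exists_section_powSucc B m
  obtain ⟨ιC, πC, hC⟩ := exists_section_powSucc C n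
  refine exteriorPullbackEquiv_mem_hodgeGroup_of_retraction
    (AbelianVariety.prodLift (AbelianVariety.fst _ _ ≫ ιB) (AbelianVariety.snd _ _ ≫ ιC))
    (AbelianVariety.prodLift (AbelianVariety.fst _ _ ≫ πB) (AbelianVariety.snd _ _ ≫ πC)) (retraction_prod hB hC)
    (fun y ↦ intertwine_prod πB πC (diagPow B u m) u (diagPow C v n) v (fun q ↦ diagPow_intertwine_right huC πB q)
      (fun z ↦ diagPow_intertwine_right hvC πC z) y) (hg'eq ▸ hg')

/-- **MOONEN–ZARHIN §1, `r = 2`, TANNAKA-FREE: `Hg(B^{m+1} × C^{n+1}) = Hg(B × C)` acting block-diagonally** — a family `g'` of automorphisms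
of the `Hᵏ((B^{m+1} × C^{n+1})(ℂ); ℂ)` lies in the Hodge group iff `g' = ⋀•(u^{⊕(m+1)} ⊕ v^{⊕(n+1)})` for `u ∈ Hg(B)|_{H¹}`, `v ∈ Hg(C)|_{H¹}` with
`⋀•(u ⊕ v) ∈ Hg(B × C)` ("we can identify `Hg(X_1^{n_1} × ⋯ × X_r^{n_r})` with `Hg(X_1 × ⋯ × X_r)`"). [cite: MoonenZarhin1999LowDim, §1] -/
theorem mem_hodgeGroup_powSucc_prod_powSucc_iff
    (g' : ∀ k : ℕ, complexBetti ((B.powSucc m).prod (C.powSucc n)).X k ≃ₗ[ℂ] complexBetti ((B.powSucc m).prod (C.powSucc n)).X k) :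
    g' ∈ hodgeGroup ((B.powSucc m).prod (C.powSucc n)).dim ((B.powSucc m).prod (C.powSucc n)).X ↔
      ∃ u ∈ hodgeGroupOne B.dim B.X, ∃ v ∈ hodgeGroupOne C.dim C.X,
        (fun k ↦ exteriorPullbackEquiv (AbelianVariety.hasExteriorCohomologyH1_complexPoints (B.prod C)) (prodBlockDiagEquiv u v) k) ∈
            hodgeGroup (B.prod C).dim (B.prod C).X ∧
          g' = fun k ↦ exteriorPullbackEquiv (AbelianVariety.hasExteriorCohomologyH1_complexPoints ((B.powSucc m).prod (C.powSucc n)))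
            (prodBlockDiagEquiv (diagPow B u m) (diagPow C v n)) k :=
  ⟨exists_of_mem_hodgeGroup_powSucc_prod_powSucc B C m n,
    fun ⟨_, hu, _, hv, h, e⟩ ↦ e ▸ diagPow_prodBlockDiagEquiv_mem_hodgeGroup_of_mem B C m n hu hv h⟩

end ProductsPowers

/-! ### §3 Moonen–Zarhin (3.1) for all exponents `m`, `n` -/

section SplitAll

variable (B C : AbelianVariety ℂ)

/-- **Splitting passes to all pairs of powers**: if `⋀•(u ⊕ v) ∈ Hg(B × C)` for all `u ∈ Hg(B)|_{H¹}`, `v ∈ Hg(C)|_{H¹}`, then the same holds for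
`(B^{m+1}, C^{n+1})` (`Hg(B^{m+1})|_{H¹} = {u^{⊕(m+1)}}`, `Hg(C^{n+1})|_{H¹} = {v^{⊕(n+1)}}`, and §2 `⊇`). [cite: MoonenZarhin1999LowDim, §1 and §3 (3.1)] -/
theorem forall_prodBlockDiagEquiv_mem_hodgeGroup_powSucc_prod_powSucc
    (hsplit : ∀ u ∈ hodgeGroupOne B.dim B.X, ∀ v ∈ hodgeGroupOne C.dim C.X,
      (fun k ↦ exteriorPullbackEquiv (AbelianVariety.hasExteriorCohomologyH1_complexPoints (B.prod C)) (prodBlockDiagEquiv u v) k) ∈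
        hodgeGroup (B.prod C).dim (B.prod C).X) (m n : ℕ) :
    ∀ u' ∈ hodgeGroupOne (B.powSucc m).dim (B.powSucc m).X, ∀ v' ∈ hodgeGroupOne (C.powSucc n).dim (C.powSucc n).X,
      (fun k ↦ exteriorPullbackEquiv (AbelianVariety.hasExteriorCohomologyH1_complexPoints ((B.powSucc m).prod (C.powSucc n)))
        (prodBlockDiagEquiv u' v') k) ∈ hodgeGroup ((B.powSucc m).prod (C.powSucc n)).dim ((B.powSucc m).prod (C.powSucc n)).X := by
  intro u' hu' v' hv'
  obtain ⟨u, hu, rfl⟩ := (mem_hodgeGroupOne_powSucc_iff B m u').1 hu'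
  obtain ⟨v, hv, rfl⟩ := (mem_hodgeGroupOne_powSucc_iff C n v').1 hv'
  exact diagPow_prodBlockDiagEquiv_mem_hodgeGroup_of_mem B C m n hu hv (hsplit u hu v hv)

/-- **MOONEN–ZARHIN (3.1), `⟹`, FOR ALL `m`, `n`**: if the Hodge group of `B × C` splits, the rational `(p,p)`-classes of EVERY
`B^{m+1} × C^{n+1}` are spanned by the exterior products of rational Hodge classes of `B^{m+1}` and of `C^{n+1}` ("`B(X_1^m × X_2^n)` is
generated by the elements coming from `B(X_1^m)` and `B(X_2^n)`"). [cite: MoonenZarhin1999LowDim, §3 (3.1)] -/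
theorem hodgeClassesProductSpan_powSucc_powSucc_of_forall_prodBlockDiagEquiv_mem_hodgeGroup
    (hsplit : ∀ u ∈ hodgeGroupOne B.dim B.X, ∀ v ∈ hodgeGroupOne C.dim C.X,
      (fun k ↦ exteriorPullbackEquiv (AbelianVariety.hasExteriorCohomologyH1_complexPoints (B.prod C)) (prodBlockDiagEquiv u v) k) ∈
        hodgeGroup (B.prod C).dim (B.prod C).X) (m n : ℕ) :
    HodgeClassesProductSpan (B.powSucc m) (C.powSucc n) :=
  hodgeClassesProductSpan_of_forall_prodBlockDiagEquiv_mem_hodgeGroup _ _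
    (forall_prodBlockDiagEquiv_mem_hodgeGroup_powSucc_prod_powSucc B C hsplit m n)

/-- **MOONEN–ZARHIN (3.1) IN ITS PRINTED FORM, TANNAKA-FREE**: the Hodge group of `B × C` splits iff for ALL `m`, `n` the Hodge classes of
`B^{m+1} × C^{n+1}` are spanned by the exterior products of Hodge classes of `B^{m+1}` and of `C^{n+1}` (`⟸` already from the equal
exponents, prequel §5). [cite: MoonenZarhin1999LowDim, §3 (3.1)] -/
theorem forall_prodBlockDiagEquiv_mem_hodgeGroup_iff_forall_hodgeClassesProductSpan_powSucc_powSucc :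
    (∀ u ∈ hodgeGroupOne B.dim B.X, ∀ v ∈ hodgeGroupOne C.dim C.X,
      (fun k ↦ exteriorPullbackEquiv (AbelianVariety.hasExteriorCohomologyH1_complexPoints (B.prod C)) (prodBlockDiagEquiv u v) k) ∈
        hodgeGroup (B.prod C).dim (B.prod C).X) ↔
      ∀ m n : ℕ, HodgeClassesProductSpan (B.powSucc m) (C.powSucc n) :=
  ⟨fun h m n ↦ hodgeClassesProductSpan_powSucc_powSucc_of_forall_prodBlockDiagEquiv_mem_hodgeGroup B C h m n,
    fun h _ hu _ hv ↦ prodBlockDiagEquiv_mem_hodgeGroup_of_forall_hodgeClassesProductSpan_powSucc B C (fun a ↦ h a a) hu hv⟩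

/-- **HC for `B^{m+1} × C^{n+1}` under splitting** from the Hodge conjecture for `B^{m+1}` and `C^{n+1}` (exterior products of algebraic
classes are algebraic, the tree's `hodgeConjectureFor_prod_of_productSpan`). A conditional implication, not a case of the summit statement.
[cite: MoonenZarhin1999LowDim, §3 (3.1)] [cite: VoisinHodgeII2003, proof of Prop. 9.20 (first display)] -/
theorem hodgeConjectureFor_powSucc_prod_powSucc_of_forall_prodBlockDiagEquiv_mem'
    (hsplit : ∀ u ∈ hodgeGroupOne B.dim B.X, ∀ v ∈ hodgeGroupOne C.dim C.X,
      (fun k ↦ exteriorPullbackEquiv (AbelianVariety.hasExteriorCohomologyH1_complexPoints (B.prod C)) (prodBlockDiagEquiv u v) k) ∈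
        hodgeGroup (B.prod C).dim (B.prod C).X) (m n : ℕ)
    (hB : HodgeConjectureFor (B.powSucc m).dim (B.powSucc m).X) (hC : HodgeConjectureFor (C.powSucc n).dim (C.powSucc n).X) :
    HodgeConjectureFor ((B.powSucc m).prod (C.powSucc n)).dim ((B.powSucc m).prod (C.powSucc n)).X :=
  hodgeConjectureFor_prod_of_productSpan _ _
    (hodgeClassesProductSpan_powSucc_powSucc_of_forall_prodBlockDiagEquiv_mem_hodgeGroup B C hsplit m n) hB hC

end SplitAll

end Literature.AlgebraicGeometry.Milne1999

end
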